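import Summits.QuantumFields.YangMills.Theorems.FluctuationComparisonRegPrIntLS2BetaTreeCombBondStep
import Summits.QuantumFields.YangMills.Theorems.FluctuationComparisonRegPrIntLS2BetaInterBlockCentral
import Literature.MathematicalPhysics.QuantumFieldTheory.Balaban1983to89.B12B0LoopGeometry267
import HarnessLib

/-!
# S2β (line g18-1, organ GAP♯∘, letter AVG₂♭-ax_q, sup chain) — (O3b) THE CENTRAL LINE OF A COARSE BOND IS TREE-COMB OFF `b₀(c)`:
# block and relative position of the sites `emb c₋ + te_μ`, and the top-stage pair AGREES on the central-line bonds other than `b₀(c)`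

Cell `ym3-torus`, seat `ym3-torus-px17` g22 (architect of the S2β AVG₂♭ sup chain), crux `stmt-QuantumFields-20520` `FluctuationComparisonRegPrIntL`, line g18-1
`semiclassical_s2beta` (registry sha16 3732b7df, UNTOUCHED), organ `stub_uniformFibreGapOrbit` (GAP♯∘).  Count-neutral helper; 0 `def`, 0 `sorry`.

WHY.  ✓p831296 `…S2BetaCoarseChordLinearReadingLocal` reads the straight-line part of a coarse chord at the distinguished bond `b₀(c)` ALONE, under the
hypothesis that the two configurations agree on the other central-line bonds `⟨emb c₋ + te_μ, μ⟩`, `t < L`, `t ≠ (L−1)/2` (`axialAvg_mul_inv_eq_conj_b0`,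
`covWalkSum_line_eq_of_eq_zero_off_b0`).  At the TOP stage of the two stage towers this hypothesis HOLDS: those bonds are tree-comb bonds of `B(c₋)` (first
half) resp. `B(c₊)` (second half) — all their coordinates relative to the block centre vanish except the `μ`-th — and on top-stage tree-comb bonds the pair
agrees (✓p828327 `…S2BetaTreeCombBondStep.stageChord_treeComb_eq_one_of_top`).  This file supplies the torus bookkeeping and the knit.

WHAT IS PROVED (kernel, 0 sorry):
* §1 `shiftN_emb_eq_transl` (`emb y + te_μ = transl (emb y) (t·e_μ)`), `shiftN_emb_src_eq_transl_tgt` (`emb c₋ + te_μ = transl (emb c₊) ((t − L)·e_μ)`, lit ✓`emb_shift`).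
* §2 `blockOf_shiftN_emb_of_le` ∕ `rel_emb_shiftN_emb_of_le` (first half: `t ≤ (L−1)/2` resp. `≤ (L+1)/2`), `blockOf_shiftN_emb_of_ge` ∕ `rel_emb_tgt_shiftN_emb_of_ge`
  (second half), via ✓`…S2BetaInterBlockCentral.blockOf_transl_emb` ∕ `rel_emb_transl`.
* §3 ★ `stage_agree_centralLine_of_top` — in the stage vocabulary of ✓p828013∕✓p828327 (`av`, `lift`, gauges `g g₀`, fields `U U₁`, T4 readings `hT4 hT4'`,
  top coincidence `htop`): `∀ t < L, t ≠ (L−1)/2 → (g_j • Ū^j U) ⟨emb c₋ + te_μ, μ⟩ = (g₀,j • Ū^j U₁) ⟨emb c₋ + te_μ, μ⟩` — exactly the `hUV` of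
  ✓p831296 `axialAvg_mul_inv_eq_conj_b0` ∕ `dist1_b0_chord_eq` ∕ `dist1_avgFun_chord_le_and`, and (with `Y := pertVar`, which vanishes where the pair agrees)
  the `hY` of `covWalkSum_line_eq_of_eq_zero_off_b0`; chord form `stageChord_centralLine_of_top`; `centralLine_eq_b0_iff` for the consumer's case split.

HONEST FRAMING.  Torus arithmetic + one application of a landed lemma; nothing of Bałaban's analysis is asserted; the ladder letters, (ST′), (ST), LOC,
AVG₂♭-ax_q, GAP♯∘, S2-β, crux 20520, `YM3TorusSU2` are NOT proved.  INHABITATION (RULING №100): n∕a (no GAP♯-shaped binder).  Rung R3 = SU(2) YM₃ on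
T³ — NOT d = 4, NOT infinite volume, NOT a mass gap, NOT Clay.
-/

namespace Summit.QuantumFields.YangMills.Theorems.FluctuationComparisonRegPrIntLS2BetaCentralLineTreeComb

open Literature.MathematicalPhysics.QuantumFieldTheory.Balaban1983to89
open T4Continuum BlockAveraging AveragingRT B10Eq47AxialChi
open B10Eq27TorusAxialLog (transl rel axialT transl_apply transl_add transl_add_e transl_zero)
open B7Prop1Explicit (e e_apply)
open B12SmallFieldDomain259 (b0)
open FluctuationComparisonRegPrIntLS2BetaInterBlockCentral (rel_emb_transl blockOf_transl_emb)
open FluctuationComparisonRegPrIntLS2BetaTreeCombBondStep (stageChord_treeComb_eq_one_of_top)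

variable {P : Params} {j : ℕ}

/-! ## §1 The central-line sites as translates of the two block centres -/

/-- `emb y + te_μ = transl (emb y) (t·e_μ)`. [cite: Balaban1987RG1, (0.1) p.252 (bookkeeping)] -/
theorem shiftN_emb_eq_transl (x : Site P j) (μ : Fin P.d) :
    ∀ t : ℕ, shiftN x μ t = transl x (fun ν => if ν = μ then (t : ℤ) else 0)
  | 0 => by
    have h : (fun ν : Fin P.d => if ν = μ then ((0 : ℕ) : ℤ) else 0) = 0 := by funext ν; simp
    rw [h, transl_zero]; rfl
  | t + 1 => by
    have h : (fun ν : Fin P.d => if ν = μ then ((t + 1 : ℕ) : ℤ) else 0) =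
        (fun ν : Fin P.d => if ν = μ then (t : ℤ) else 0) + e μ := by
      funext ν; simp only [Pi.add_apply, e_apply]
      split_ifs
      · push_cast; ring
      · simp
    rw [shiftN_succ, shiftN_emb_eq_transl x μ t, h, transl_add_e]

/-- `emb c₋ + te_μ = transl (emb c₊) ((t − L)·e_μ)` (the centres of `B(c₋)`, `B(c₊)` are `L` steps apart, lit ✓`emb_shift`). [cite: Balaban1987RG1, (0.1) p.252] -/
theorem shiftN_emb_src_eq_transl_tgt (hj : j + 1 ≤ P.m + P.K) (c : PBond P (j + 1)) (t : ℕ) :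
    shiftN (emb c.src) c.dir t = transl (emb c.tgt) (fun ν => if ν = c.dir then (t : ℤ) - P.L else 0) := by
  have htgt : emb c.tgt = shiftN (emb c.src) c.dir P.L := emb_shift hj c.src c.dir
  rw [htgt, shiftN_emb_eq_transl, shiftN_emb_eq_transl, ← transl_add]
  congr 1
  funext ν
  simp only [Pi.add_apply]
  split_ifs <;> ring

/-! ## §2 Block and relative position of the central-line sites -/

/-- First half: `emb c₋ + te_μ ∈ B(c₋)` for `t ≤ (L−1)/2`. [cite: Balaban1987RG1, (0.1) p.252] -/
theorem blockOf_shiftN_emb_of_le (hj : j + 1 ≤ P.m + P.K) (y : Site P (j + 1)) (μ : Fin P.d) {t : ℕ} (ht : t ≤ (P.L - 1) / 2) :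
    blockOf (shiftN (emb y) μ t) = y := by
  rw [shiftN_emb_eq_transl]
  exact blockOf_transl_emb hj y fun ν => by split_ifs <;> simp [ht]

/-- First half: the position of `emb c₋ + te_μ` relative to the centre of `B(c₋)` is `t·e_μ` (`t ≤ (L+1)/2`, no wrap-around). [cite: Balaban1987RG1, (0.3) p.252] -/
theorem rel_emb_shiftN_emb_of_le (hj : j + 1 ≤ P.m + P.K) (y : Site P (j + 1)) (μ : Fin P.d) {t : ℕ} (ht : t ≤ (P.L - 1) / 2 + 1) :
    rel (emb y) (shiftN (emb y) μ t) = fun ν => if ν = μ then (t : ℤ) else 0 := by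
  rw [shiftN_emb_eq_transl]
  exact rel_emb_transl hj y fun ν => by split_ifs <;> simp [ht]

/-- Second half: `emb c₋ + te_μ ∈ B(c₊)` for `(L+1)/2 ≤ t ≤ L + (L−1)/2`. [cite: Balaban1987RG1, (0.1) p.252] -/
theorem blockOf_shiftN_emb_of_ge (hj : j + 1 ≤ P.m + P.K) (c : PBond P (j + 1)) {t : ℕ} (h1 : (P.L - 1) / 2 + 1 ≤ t) (h2 : t ≤ P.L + (P.L - 1) / 2) :
    blockOf (shiftN (emb c.src) c.dir t) = c.tgt := by
  have hL := two_mul_half_add_one P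
  rw [shiftN_emb_src_eq_transl_tgt hj]
  exact blockOf_transl_emb hj c.tgt fun ν => by split_ifs <;> omega

/-- Second half: the position of `emb c₋ + te_μ` relative to the centre of `B(c₊)` is `(t − L)·e_μ` (`(L−1)/2 ≤ t ≤ L + (L+1)/2`). [cite: Balaban1987RG1, (0.3) p.252] -/
theorem rel_emb_tgt_shiftN_emb_of_ge (hj : j + 1 ≤ P.m + P.K) (c : PBond P (j + 1)) {t : ℕ} (h1 : (P.L - 1) / 2 ≤ t) (h2 : t ≤ P.L + (P.L - 1) / 2 + 1) :
    rel (emb c.tgt) (shiftN (emb c.src) c.dir t) = fun ν => if ν = c.dir then (t : ℤ) - P.L else 0 := by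
  have hL := two_mul_half_add_one P
  rw [shiftN_emb_src_eq_transl_tgt hj]
  exact rel_emb_transl hj c.tgt fun ν => by split_ifs <;> omega

/-! ## §3 The top-stage pair agrees on the central line off `b₀(c)` -/

variable {G : Type*} [GaugeGroup G]

/-- ★ **AT THE TOP STAGE THE PAIR AGREES ON THE CENTRAL-LINE BONDS OTHER THAN `b₀(c)`** (they are tree-comb bonds of `B(c₋)` resp. `B(c₊)`: relative
coordinates below — indeed other than — `μ` vanish, and the next site along `μ` stays in the block; ✓p828327 `stageChord_treeComb_eq_one_of_top`).  This is the
`hUV` of ✓p831296 `axialAvg_mul_inv_eq_conj_b0` ∕ `dist1_b0_chord_eq` ∕ `dist1_avgFun_chord_le_and` for the top-stage pair. [cite: Balaban1985Averaging, (58) p.27; Balaban1987RG1, p.267] -/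
theorem stage_agree_centralLine_of_top (av : ∀ i, Averaging P i G) (hj : j + 1 ≤ P.m + P.K)
    (lift : (i : ℕ) → GaugeField P (i + 1) G → GaugeField P i G) (g g₀ : (i : ℕ) → Site P i → G) (U U₁ : GaugeField P 0 G)
    (hT4 : ∀ x, axialT (GaugeField.gaugeAct (g j) (Averaging.iter av j U)) (emb (blockOf x)) x =
      axialT (lift j (GaugeField.gaugeAct (g (j + 1)) (Averaging.iter av (j + 1) U))) (emb (blockOf x)) x)
    (hT4' : ∀ x, axialT (GaugeField.gaugeAct (g₀ j) (Averaging.iter av j U₁)) (emb (blockOf x)) x =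
      axialT (lift j (GaugeField.gaugeAct (g₀ (j + 1)) (Averaging.iter av (j + 1) U₁))) (emb (blockOf x)) x)
    (htop : GaugeField.gaugeAct (g (j + 1)) (Averaging.iter av (j + 1) U) = GaugeField.gaugeAct (g₀ (j + 1)) (Averaging.iter av (j + 1) U₁))
    (c : PBond P (j + 1)) (t : ℕ) (ht : t < P.L) (hne : t ≠ (P.L - 1) / 2) :
    GaugeField.gaugeAct (g j) (Averaging.iter av j U) ⟨shiftN (emb c.src) c.dir t, c.dir⟩ =
      GaugeField.gaugeAct (g₀ j) (Averaging.iter av j U₁) ⟨shiftN (emb c.src) c.dir t, c.dir⟩ := by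
  have hL := two_mul_half_add_one P
  refine stageChord_treeComb_eq_one_of_top av hj lift g g₀ U U₁ hT4 hT4' htop (shiftN (emb c.src) c.dir t) c.dir ?_ ?_
  · -- the next site along `μ` stays in the same block
    rw [← shiftN_succ]
    rcases lt_or_gt_of_ne hne with hlt | hgt
    · rw [blockOf_shiftN_emb_of_le hj c.src c.dir (t := t + 1) (by omega), blockOf_shiftN_emb_of_le hj c.src c.dir (t := t) (by omega)]
    · rw [blockOf_shiftN_emb_of_ge hj c (t := t + 1) (by omega) (by omega), blockOf_shiftN_emb_of_ge hj c (t := t) (by omega) (by omega)]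
  · -- the lower relative coordinates vanish
    intro ν hν
    have hνne : ν ≠ c.dir := fun h => by rw [h] at hν; exact lt_irrefl _ hν
    rcases lt_or_gt_of_ne hne with hlt | hgt
    · rw [blockOf_shiftN_emb_of_le hj c.src c.dir (t := t) (by omega), rel_emb_shiftN_emb_of_le hj c.src c.dir (t := t) (by omega)]
      simp [hνne]
    · rw [blockOf_shiftN_emb_of_ge hj c (t := t) (by omega) (by omega), rel_emb_tgt_shiftN_emb_of_ge hj c (t := t) (by omega) (by omega)]
      simp [hνne]

/-- ★ The same in chord form: the top-stage chord `U′_j b·(U₁′_j b)⁻¹ = 1` on every central-line bond `b ≠ b₀(c)`. [cite: Balaban1985Averaging, (58) p.27; Balaban1987RG1, p.267] -/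
theorem stageChord_centralLine_of_top (av : ∀ i, Averaging P i G) (hj : j + 1 ≤ P.m + P.K)
    (lift : (i : ℕ) → GaugeField P (i + 1) G → GaugeField P i G) (g g₀ : (i : ℕ) → Site P i → G) (U U₁ : GaugeField P 0 G)
    (hT4 : ∀ x, axialT (GaugeField.gaugeAct (g j) (Averaging.iter av j U)) (emb (blockOf x)) x =
      axialT (lift j (GaugeField.gaugeAct (g (j + 1)) (Averaging.iter av (j + 1) U))) (emb (blockOf x)) x)
    (hT4' : ∀ x, axialT (GaugeField.gaugeAct (g₀ j) (Averaging.iter av j U₁)) (emb (blockOf x)) x =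
      axialT (lift j (GaugeField.gaugeAct (g₀ (j + 1)) (Averaging.iter av (j + 1) U₁))) (emb (blockOf x)) x)
    (htop : GaugeField.gaugeAct (g (j + 1)) (Averaging.iter av (j + 1) U) = GaugeField.gaugeAct (g₀ (j + 1)) (Averaging.iter av (j + 1) U₁))
    (c : PBond P (j + 1)) (t : ℕ) (ht : t < P.L) (hne : t ≠ (P.L - 1) / 2) :
    GaugeField.gaugeAct (g j) (Averaging.iter av j U) ⟨shiftN (emb c.src) c.dir t, c.dir⟩ *
      (GaugeField.gaugeAct (g₀ j) (Averaging.iter av j U₁) ⟨shiftN (emb c.src) c.dir t, c.dir⟩)⁻¹ = 1 := by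
  rw [stage_agree_centralLine_of_top av hj lift g g₀ U U₁ hT4 hT4' htop c t ht hne, mul_inv_cancel]

/-- The distinguished bond is the central-line bond at `t = (L−1)/2` (lit ✓`b0_eq_shiftN_emb`, restated as membership of the central line for the
consumer's case split). [cite: Balaban1987RG1, p.267] -/
theorem centralLine_eq_b0_iff (hj : j + 1 ≤ P.m + P.K) (c : PBond P (j + 1)) {t : ℕ} (ht : t < P.L) :
    (⟨shiftN (emb c.src) c.dir t, c.dir⟩ : PBond P j) = b0 c ↔ t = (P.L - 1) / 2 := by
  rw [B12B0LoopGeometry267.b0_eq_shiftN_emb]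
  constructor
  · intro h
    have hs := congrArg PBond.src h
    simp only at hs
    rw [B12B0LoopGeometry267.emb_eq_blockSite] at hs
    exact B12B0LoopGeometry267.shiftN_blockSite_injOn hj c _ ht (half_lt P) hs
  · rintro rfl; rfl

end Summit.QuantumFields.YangMills.Theorems.FluctuationComparisonRegPrIntLS2BetaCentralLineTreeComb
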